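import Summits.QuantumFields.BalabanUV.T4Continuum.Support.B13AvgCorrPlaquette
import Summits.QuantumFields.BalabanUV.T4Continuum.Support.SubstrateBackgroundTransporters

/-!
# B13AvgCorrPlaquetteWindow — row NE5, κ-DISCHARGE programme (T4-DAG §8 Q49 (a′); design note
# `HOME/t4/b2b-balaban-t4-ne5-p1/g39/KAPPA-NE5-DESIGN.md` §1∕(K1-c)), the CONSUMER FACES of leaf κ-L2: the plaquette bound of
# `B13AvgCorrPlaquette` READ (a) at the substrate's transporter tower of record `towerOf` and (b) directly on a fine field in the
# (α, β)-window — `dist1 (V(∂p)) ≤ (2β + 2α²)∕L^(2K)`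

Cell `pub-balaban`, unit `b2b-balaban-t4-ne5-formalise-leaf-07` (NE5 formalisation swarm LEAF PROVER 07, gen 17; a CLAIM RULE 1 follower of the
row owner's κ-L2 `Support/B13AvgCorrPlaquette` (t4-ne5-p1 g39-c), written as the kernel part of this seat's XREAD X1 of that module and filed
with the owner's leave).  Summits-side NEW WORK under the LEAN PLACEMENT RULE: [folklore] bookkeeping — the END `norm_plaquette_sub_one_le_of_reg` ∕
the §1 bound `norm_plaquette_sub_one_le` applied ONCE and rewritten into `dist1`∕`GaugeField.plaqHol` words; 0 `def`, no `Prop`-valued fact minted,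
nothing printed asserted, no citation tag.  HONEST FRAMING: rung (B)+1 of the FINITE-VOLUME T⁴ programme — NOT infinite volume, NOT a mass gap,
NOT the Clay problem, NOT a proof of NE5 (NOT PRINTED; GAPS G-t4-U3-1); κ is NOT discharged here (κ-END's, from κ-L1…κ-L4); nothing of
[Balaban1985Averaging] ∕ [Balaban1987RG1] instantiated.  HONEST DEPENDENCY (cell, verbatim): continuum YM on T⁴ ⇐ BetaPertH ∧ nine spine
estimates (0/9 proved); BetaPertH ⇐ (D1) ∧ (D4) ∧ CAP+tail; G-an2-4 gates asym, D1 and NE2/3/4.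

* §1 `towerOf_mem_unitaryGroup` — the END's unitarity binder `hU` DISCHARGED at `towerOf P ι U` for a unitary-valued `ι` (in range by
  `transV_mem_unitaryGroup`, out of range the padding `1`); `map_inv_eq_star` (`ι g⁻¹ = (ι g)⋆`, `UnitaryModel.map_inv_eq_conjTranspose`).
* §2 `dist1_plaq_towerOf_le` ∕ `dist1_plaqHol_towerOf_le` — the END at the tower of record of a run `U` whose levels carry the V1 size ∕ Lipschitz
  letters (`SubstrateBackgroundTransporters.regularTransporters_towerOf`): `∀ k ≤ K, dist1 (U_{K−k}(∂p)) ≤ (2β + 2α²)∕(lev L k)²`.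
* §3 `dist1_plaq_le_of_window` ∕ `dist1_plaqHol_le_of_window` ∕ `dist1_plaqHol_inv_le_of_window` — THE FACE κ-L1∕κ-END CONSUME: for
  `V : GaugeField P 0 G` with `L^K·dist1 (V b) ≤ α` and `L^K·‖ι(V(x+e_μ, ν)) − ι(V(x, ν))‖ ≤ β∕L^K`, every (raw, either orientation, also
  degenerate `μ = ν`) plaquette word is within `(2β + 2α²)∕L^(2K)` of `1` in `dist1` — design (K1-c) VERBATIM with (α′, β′) := (α, β).
0 sorry; axioms ⊆ {propext, Classical.choice, Quot.sound}.
-/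

noncomputable section

open scoped Matrix Matrix.Norms.L2Operator

namespace Summit.QuantumFields.BalabanUV.T4Continuum.B13AvgCorrPlaquetteWindow

open Literature.MathematicalPhysics.QuantumFieldTheory.Balaban1983to89
open Literature.MathematicalPhysics.QuantumFieldTheory.Balaban1983to89.B5Prop11Plancherel (fine Tor)
open Literature.MathematicalPhysics.QuantumFieldTheory.Balaban1983to89.B5G183RateUnitTower (lev lev_neZero)
open Summit.QuantumFields.BalabanUV.T4Continuum.BalabanAveragedTowerUnit (idx one_le_lev' cast_lev')
open Summit.QuantumFields.BalabanUV.T4Continuum.BlockPairingGeometry (tau)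
open Summit.QuantumFields.BalabanUV.T4Continuum.RegularBackgroundTower (RegularTransporters)
open Summit.QuantumFields.BalabanUV.T4Continuum.SubstrateBackgroundTransporters
open Summit.QuantumFields.BalabanUV.T4Continuum.B13AvgCorrPlaquette

variable {P : Params} {G : Type*} [GaugeGroup G] {o : Type*} [Fintype o] [DecidableEq o] (ι : G →* Matrix o o ℂ)

/-! ## §1 The unitarity binder at the tower of record -/

/-- [folklore] The END's `hU` binder DISCHARGED at the substrate's tower of record: for a unitary-valued representation `ι`, every entry of
`towerOf P ι U` is unitary (in range `k ≤ K` it is an `ι`-image, out of range it is the padding `1`). -/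
theorem towerOf_mem_unitaryGroup (hι : ∀ g, ι g ∈ Matrix.unitaryGroup o ℂ) (U : (j : ℕ) → GaugeField P j G)
    (k : ℕ) (μ : Fin P.d) (i : idx P.L (unitMod P) k) : towerOf P ι U k μ i ∈ Matrix.unitaryGroup o ℂ := by
  rcases le_or_gt k P.K with hk | hk
  · rw [towerOf_of_le ι U hk]; exact transV_mem_unitaryGroup _ hι _ _ _
  · rw [towerOf_of_lt ι U hk]; exact Submonoid.one_mem _

/-- [folklore] A unitary-valued representation sends inverses to adjoints: `ι g⁻¹ = (ι g)⋆` (`UnitaryModel.map_inv_eq_conjTranspose` in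
`star` words; the `Matrix (Fin Nc) (Fin Nc) ℂ` case is the tree's `TiltedTorusRP.map_inv_eq_star` — here for a general index type `o`, as
`towerOf` needs). -/
theorem map_inv_eq_star (hι : ∀ g, ι g ∈ Matrix.unitaryGroup o ℂ) (g : G) : ι g⁻¹ = star (ι g) := by
  rw [UnitaryModel.map_inv_eq_conjTranspose ι hι, Matrix.star_eq_conjTranspose]

/-! ## §2 The END read at the tower of record of a run -/

/-- [folklore] **THE PLAQUETTES OF A RUN AT THE TOWER OF RECORD**: if every level `j = K − k` of the run `U` carries the V1 size letter
`L^k·dist1 (U_j b) ≤ α` and the Lipschitz letter `L^k·‖ι(U_j(x+e_μ, ν)) − ι(U_j(x, ν))‖ ≤ β∕L^k`, then for every `k ≤ K`, site `x` and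
directions `μ, ν`, `dist1 (U_j(x,μ)·U_j(x+e_μ,ν)·U_j(x+e_ν,μ)⁻¹·U_j(x,ν)⁻¹) ≤ (2β + 2α²)∕(lev L k)²` — `norm_plaquette_sub_one_le_of_reg` applied
ONCE at `i = (siteIdx x, μ)` with `regularTransporters_towerOf` and §1, rewritten by `tau_siteIdx`, `towerOf_chart`, `map_inv_eq_star`,
`map_mul` and `‖ι h − 1‖ = dist1 h`. -/
theorem dist1_plaq_towerOf_le (hι : ∀ g, ι g ∈ Matrix.unitaryGroup o ℂ) (hdist : ∀ g, ‖ι g - 1‖ = dist1 g)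
    (U : (j : ℕ) → GaugeField P j G) {α β : ℝ} (hα : 0 ≤ α) (hβ : 0 ≤ β)
    (hsize : ∀ k, k ≤ P.K → ∀ b : PBond P (P.K - k), (P.L : ℝ) ^ k * dist1 (U (P.K - k) b) ≤ α)
    (hlip : ∀ k, k ≤ P.K → ∀ (x : Site P (P.K - k)) (ν μ : Fin P.d),
      (P.L : ℝ) ^ k * ‖ι (U (P.K - k) ⟨x.shift μ, ν⟩) - ι (U (P.K - k) ⟨x, ν⟩)‖ ≤ β / (P.L : ℝ) ^ k)
    {k : ℕ} (hk : k ≤ P.K) (x : Site P (P.K - k)) (μ ν : Fin P.d) :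
    dist1 (U (P.K - k) ⟨x, μ⟩ * U (P.K - k) ⟨x.shift μ, ν⟩ * (U (P.K - k) ⟨x.shift ν, μ⟩)⁻¹ * (U (P.K - k) ⟨x, ν⟩)⁻¹)
      ≤ (2 * β + 2 * α ^ 2) / ((lev P.L k : ℕ) : ℝ) ^ 2 := by
  have hreg := regularTransporters_towerOf (ι := ι) hdist U hα hβ hsize hlip
  have h := norm_plaquette_sub_one_le_of_reg P.L (unitMod P) hreg (towerOf_mem_unitaryGroup ι hι U) k μ ν
    (siteIdx P (j := P.K - k) (k := k) (by omega) x, μ)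
  rw [tau_siteIdx, tau_siteIdx, towerOf_chart ι U hk, towerOf_chart ι U hk, towerOf_chart ι U hk, towerOf_chart ι U hk,
    ← map_inv_eq_star ι hι, ← map_inv_eq_star ι hι, ← map_mul, ← map_mul, ← map_mul, hdist] at h
  exact h

/-- [folklore] §2 in `plaqHol` words: the level-`(K − k)` PLAQUETTE VARIABLES (B7 (9)) of the run are within `(2β + 2α²)∕(lev L k)²` of `1`. -/
theorem dist1_plaqHol_towerOf_le (hι : ∀ g, ι g ∈ Matrix.unitaryGroup o ℂ) (hdist : ∀ g, ‖ι g - 1‖ = dist1 g)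
    (U : (j : ℕ) → GaugeField P j G) {α β : ℝ} (hα : 0 ≤ α) (hβ : 0 ≤ β)
    (hsize : ∀ k, k ≤ P.K → ∀ b : PBond P (P.K - k), (P.L : ℝ) ^ k * dist1 (U (P.K - k) b) ≤ α)
    (hlip : ∀ k, k ≤ P.K → ∀ (x : Site P (P.K - k)) (ν μ : Fin P.d),
      (P.L : ℝ) ^ k * ‖ι (U (P.K - k) ⟨x.shift μ, ν⟩) - ι (U (P.K - k) ⟨x, ν⟩)‖ ≤ β / (P.L : ℝ) ^ k)
    {k : ℕ} (hk : k ≤ P.K) (p : Plaq P (P.K - k)) :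
    dist1 (GaugeField.plaqHol (U (P.K - k)) p) ≤ (2 * β + 2 * α ^ 2) / ((lev P.L k : ℕ) : ℝ) ^ 2 :=
  dist1_plaq_towerOf_le ι hι hdist U hα hβ hsize hlip hk p.src p.μ p.ν

/-! ## §3 The consumer face on a fine field in the (α, β)-window — design (K1-c) -/

/-- [folklore] **THE FINEST PLAQUETTES OF A FIELD IN THE WINDOW (design (K1-c))**, raw form — ANY `x, μ, ν` (both orientations, and the
degenerate `μ = ν`): for `V : GaugeField P 0 G` with `L^K·dist1 (V b) ≤ α` (size) and `L^K·‖ι(V(x+e_μ, ν)) − ι(V(x, ν))‖ ≤ β∕L^K`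
(lattice-Lipschitz), `dist1 (V(x,μ)·V(x+e_μ,ν)·V(x+e_ν,μ)⁻¹·V(x,ν)⁻¹) ≤ (2β + 2α²)∕L^(2K)` — `norm_plaquette_sub_one_le` applied ONCE to the
four `ι`-images (two Lipschitz letters `β∕L^(2K)`, one commutator `2(α∕L^K)²`); no tower, no chart. -/
theorem dist1_plaq_le_of_window (hι : ∀ g, ι g ∈ Matrix.unitaryGroup o ℂ) (hdist : ∀ g, ‖ι g - 1‖ = dist1 g)
    (V : GaugeField P 0 G) {α β : ℝ}
    (hsize : ∀ b : PBond P 0, (P.L : ℝ) ^ P.K * dist1 (V b) ≤ α)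
    (hlip : ∀ (x : Site P 0) (ν μ : Fin P.d), (P.L : ℝ) ^ P.K * ‖ι (V ⟨x.shift μ, ν⟩) - ι (V ⟨x, ν⟩)‖ ≤ β / (P.L : ℝ) ^ P.K)
    (x : Site P 0) (μ ν : Fin P.d) :
    dist1 (V ⟨x, μ⟩ * V ⟨x.shift μ, ν⟩ * (V ⟨x.shift ν, μ⟩)⁻¹ * (V ⟨x, ν⟩)⁻¹) ≤ (2 * β + 2 * α ^ 2) / (P.L : ℝ) ^ (2 * P.K) := by
  have hL : (0 : ℝ) < (P.L : ℝ) ^ P.K := pow_pos (by exact_mod_cast P.L_pos) _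
  have hsz : ∀ b : PBond P 0, ‖ι (V b) - 1‖ ≤ α / (P.L : ℝ) ^ P.K := fun b => by
    rw [hdist, le_div_iff₀ hL, mul_comm]; exact hsize b
  have hlp : ∀ (x : Site P 0) (ν μ : Fin P.d), ‖ι (V ⟨x.shift μ, ν⟩) - ι (V ⟨x, ν⟩)‖ ≤ β / ((P.L : ℝ) ^ P.K) ^ 2 :=
    fun x ν μ => by rw [sq, ← div_div, le_div_iff₀ hL, mul_comm]; exact hlip x ν μ
  have ha1 : ‖ι (V ⟨x, μ⟩)‖ ≤ 1 := by
    rcases isEmpty_or_nonempty o with ho | ho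
    · have : ι (V ⟨x, μ⟩) = 0 := Subsingleton.elim _ _
      rw [this, norm_zero]; exact zero_le_one
    · exact (CStarRing.norm_of_mem_unitary (hι _)).le
  have hmain := norm_plaquette_sub_one_le (ι (V ⟨x, μ⟩)) (ι (V ⟨x.shift μ, ν⟩)) (hι (V ⟨x.shift ν, μ⟩)) (hι (V ⟨x, ν⟩))
  rw [← map_inv_eq_star ι hι, ← map_inv_eq_star ι hι, ← map_mul, ← map_mul, ← map_mul, hdist] at hmain
  rw [pow_mul']
  refine hmain.trans ?_
  have hbd := hlp x ν μ
  have hac : ‖ι (V ⟨x, μ⟩) - ι (V ⟨x.shift ν, μ⟩)‖ ≤ β / ((P.L : ℝ) ^ P.K) ^ 2 := by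
    rw [norm_sub_rev]; exact hlp x μ ν
  have ha := hsz ⟨x, μ⟩
  have hb := hsz ⟨x.shift μ, ν⟩
  have hβ0 : 0 ≤ β / ((P.L : ℝ) ^ P.K) ^ 2 := le_trans (norm_nonneg _) hbd
  have hα0 : 0 ≤ α / (P.L : ℝ) ^ P.K := le_trans (norm_nonneg _) ha
  calc ‖ι (V ⟨x.shift μ, ν⟩) - ι (V ⟨x, ν⟩)‖ * ‖ι (V ⟨x, μ⟩)‖ + ‖ι (V ⟨x, μ⟩) - ι (V ⟨x.shift ν, μ⟩)‖
        + 2 * (‖ι (V ⟨x, μ⟩) - 1‖ * ‖ι (V ⟨x.shift μ, ν⟩) - 1‖)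
      ≤ β / ((P.L : ℝ) ^ P.K) ^ 2 * 1 + β / ((P.L : ℝ) ^ P.K) ^ 2
        + 2 * (α / (P.L : ℝ) ^ P.K * (α / (P.L : ℝ) ^ P.K)) := by
        gcongr
    _ = (2 * β + 2 * α ^ 2) / ((P.L : ℝ) ^ P.K) ^ 2 := by field_simp; ring

/-- [folklore] §3 in `plaqHol` words (positively oriented plaquettes `p : Plaq P 0`, B7 (9)): `dist1 (V(∂p)) ≤ (2β + 2α²)∕L^(2K)`. -/
theorem dist1_plaqHol_le_of_window (hι : ∀ g, ι g ∈ Matrix.unitaryGroup o ℂ) (hdist : ∀ g, ‖ι g - 1‖ = dist1 g)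
    (V : GaugeField P 0 G) {α β : ℝ}
    (hsize : ∀ b : PBond P 0, (P.L : ℝ) ^ P.K * dist1 (V b) ≤ α)
    (hlip : ∀ (x : Site P 0) (ν μ : Fin P.d), (P.L : ℝ) ^ P.K * ‖ι (V ⟨x.shift μ, ν⟩) - ι (V ⟨x, ν⟩)‖ ≤ β / (P.L : ℝ) ^ P.K)
    (p : Plaq P 0) : dist1 (GaugeField.plaqHol V p) ≤ (2 * β + 2 * α ^ 2) / (P.L : ℝ) ^ (2 * P.K) :=
  dist1_plaq_le_of_window ι hι hdist V hsize hlip p.src p.μ p.ν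

/-- [folklore] The bound is orientation-blind: the INVERSE plaquette variable obeys it too (`dist1_inv`), as the plaquette lassos of the
Stokes road (κ-L1) traverse plaquettes in both orientations. -/
theorem dist1_plaqHol_inv_le_of_window (hι : ∀ g, ι g ∈ Matrix.unitaryGroup o ℂ) (hdist : ∀ g, ‖ι g - 1‖ = dist1 g)
    (V : GaugeField P 0 G) {α β : ℝ}
    (hsize : ∀ b : PBond P 0, (P.L : ℝ) ^ P.K * dist1 (V b) ≤ α)
    (hlip : ∀ (x : Site P 0) (ν μ : Fin P.d), (P.L : ℝ) ^ P.K * ‖ι (V ⟨x.shift μ, ν⟩) - ι (V ⟨x, ν⟩)‖ ≤ β / (P.L : ℝ) ^ P.K)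
    (p : Plaq P 0) : dist1 (GaugeField.plaqHol V p)⁻¹ ≤ (2 * β + 2 * α ^ 2) / (P.L : ℝ) ^ (2 * P.K) := by
  rw [GaugeGroup.dist1_inv]; exact dist1_plaqHol_le_of_window ι hι hdist V hsize hlip p

end Summit.QuantumFields.BalabanUV.T4Continuum.B13AvgCorrPlaquetteWindow

end
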